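import Mathlib
import Literature.Analysis.Matrix.TraceJensenInequality
import Literature.Analysis.Matrix.BallCarlenLiebKey
import Literature.Analysis.Matrix.BallCarlenLiebLocal
import HarnessLib

/-!
# Ball–Carlen–Lieb optimal 2-uniform convexity of `S_p` (`1 ≤ p ≤ 2`), III: the two-point inequality
# for real symmetric matrices

Sources: K. Ball, E. Carlen, E. H. Lieb, *Sharp uniform convexity and smoothness inequalities for trace
norms*, Invent. Math. 115 (1994) 463–482 [BallCarlenLieb1994], Thm. 1: for `1 ≤ p ≤ 2`,
`‖X+Y‖_p² + ‖X−Y‖_p² ≥ 2‖X‖_p² + 2(p−1)‖Y‖_p²` with the optimal constant `p − 1`; É. Ricard, Q. Xu,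
Ann. Probab. 44 (2016) = arXiv:1405.0431 [RicardXu2016], §2 (held text pp. 4–6, read first-hand): the
pseudo-differentiation proof — `D²f ≥ 0 ⇒ f convex` (the lemma opening §2), Lemma 5 ((D²_{a,b}) at an
invertible point), and the proof of Thm. 2 (convexity of `t ↦ ‖x+ty‖_p² − (p−1)t²‖y‖_p²`, then `ε → 0`);
A. Ben-Aroya, O. Regev, R. de Wolf, FOCS 2008 = arXiv:0705.3806 [BenAroyaRegevDeWolf2008], Lemma 4 (§3,
held text p. 9): the power-mean form `‖(A+B)/2‖_p² + (p−1)‖(A−B)/2‖_p² ≤ ((‖A‖_p^p+‖B‖_p^p)/2)^{2/p}`.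

THIS FILE proves the two-point inequality for REAL SYMMETRIC matrices of any finite size, following
Ricard–Xu's architecture with the matrix-case simplifications:

* (`RealAnalysis`) the pseudo-derivative lemma `convexOn_Icc_of_second_difference` (a continuous function
  whose second differences are `≥ −εh²` for small `h` at every interior point is convex — the interior
  maximum argument of [RicardXu2016, §2]); gluing of convexity across finitely many kinks for
  `g = Φ − κt²` with `Φ` convex (`convexOn_Icc_glue`, `convexOn_Icc_of_finite_kinks`: at a kink the
  one-sided slopes of `Φ` can only jump up);
* (`MatrixLemmas`) convexity and continuity of `t ↦ Tr|X+tY|^p` and of `t ↦ (Tr|X+tY|^p)^{2/p}` (trace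
  Jensen, tree `TraceJensen.re_trace_cfc_convex_le`); finiteness of the singular parameters
  `{t : det(X+tY) = 0}` for invertible `X` and invertibility of `X + ε·1` for small `ε > 0` (polynomials);
  `Tr|A ⊕ B|^p = Tr|A|^p + Tr|B|^p`, `Tr|−Y|^p = Tr|Y|^p`;
* (`Global`) `convexOn_normSq_sub_sq`: for invertible `X`, `t ↦ ‖X+tY‖_p² − (p−1)t²‖Y‖_p²` is convex on
  `ℝ` (local bound `BallCarlenLiebLocal.normSq_second_difference` at nonsingular `t` + the two items
  above) — in the matrix case the singular `t` are finitely many, so no diffuse perturbation is needed,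
  cf. [RicardXu2016, §1: "This invertibility is easily achieved in the matrix algebra case"]; evaluating
  at `t = ±1` gives (BCL) for invertible `X` (`two_point_sq_of_det`), `X + ε·1`, `ε → 0⁺` removes
  invertibility (`two_point_sq_of_lt`), continuity in `p` gives the endpoints `p = 1, 2` (`two_point_sq`),
  and the block trick `X ⊕ X`, `Y ⊕ (−Y)` gives the power-mean form (`two_point_powerMean`).

Main statements (`X`, `Y` real symmetric, index type nonempty, `1 ≤ p ≤ 2`, `Tr|M|^p = trAbsPow p M`):
`two_point_sq : 2 (Tr|X|^p)^{2/p} + 2(p−1)(Tr|Y|^p)^{2/p} ≤ (Tr|X+Y|^p)^{2/p} + (Tr|X−Y|^p)^{2/p}`,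
`two_point_powerMean : (Tr|X|^p)^{2/p} + (p−1)(Tr|Y|^p)^{2/p} ≤ ((Tr|X+Y|^p + Tr|X−Y|^p)/2)^{2/p}`.
Consumer: the discharge of `MatrixHypercontractivity.BenAroyaRegevDeWolf2008_thm1` (normalised
Schatten norms on `Fin d`). Everything here is PROVED; no named facts, no instances, no notation.
WHAT THIS IS NOT: complex / non-Hermitian matrices (singular values) and the case `p > 2` are not treated.
-/

noncomputable section
open Real Matrix Finset Filter
open scoped Topology

namespace Literature.Analysis.Matrix.BallCarlenLieb

section RealAnalysis


/-! ### Convexity from a lower bound on second differences (Ricard–Xu's pseudo-derivative lemma) -/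

/-- **Convexity from nonnegative pseudo-second-derivative.** If `f` is continuous on `[x, z]` and at
every interior point `s` the second differences satisfy
`liminf_{h→0⁺} (f(s+h) + f(s-h) - 2f(s))/h² ≥ 0` (in the `ε`-form below), then `f` is convex on
`[x, z]`: otherwise `f - ℓ - η(t-a)(b-t)` has an interior maximum, where its second differences are
`≥ ηh² > 0`. [cite: RicardXu2016, §2 (the pseudo-differentiation lemma before (D²_{x,y}))] -/
theorem convexOn_Icc_of_second_difference {f : ℝ → ℝ} {x z : ℝ}
    (hf : ContinuousOn f (Set.Icc x z))
    (hD : ∀ s, x < s → s < z → ∀ ε > 0, ∃ δ > 0, ∀ h, 0 < h → h < δ →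
      -(ε * h ^ 2) ≤ f (s + h) + f (s - h) - 2 * f s) :
    ConvexOn ℝ (Set.Icc x z) f := by
  -- the case `a < b`
  have aux : ∀ a ∈ Set.Icc x z, ∀ b ∈ Set.Icc x z, a < b → ∀ μ ν : ℝ, 0 ≤ μ → 0 ≤ ν → μ + ν = 1 →
      f (μ * a + ν * b) ≤ μ * f a + ν * f b := by
    intro a ha b hb hab μ ν hμ hν hμν
    by_contra H
    rw [not_le] at H
    set y := μ * a + ν * b with hy
    set gap := f y - (μ * f a + ν * f b) with hgap
    have hgap0 : 0 < gap := by rw [hgap]; linarith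
    have hba : 0 < b - a := by linarith
    -- the affine interpolant and the perturbed function
    set η := gap / (2 * (b - a) ^ 2) with hη
    have hη0 : 0 < η := by rw [hη]; positivity
    set F : ℝ → ℝ := fun t => f t - (f a + (f b - f a) / (b - a) * (t - a)) - η * ((t - a) * (b - t))
      with hF
    have hFa : F a = 0 := by simp only [hF]; ring
    have hFb : F b = 0 := by
      have : (f b - f a) / (b - a) * (b - a) = f b - f a := div_mul_cancel₀ _ hba.ne'
      simp only [hF]; rw [this]; ring
    have hya : y - a = ν * (b - a) := by rw [hy]; linear_combination a * hμν
    have hby : b - y = μ * (b - a) := by rw [hy]; linear_combination (-b) * hμν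
    have hy1 : a ≤ y := by nlinarith [mul_nonneg hν hba.le]
    have hy2 : y ≤ b := by nlinarith [mul_nonneg hμ hba.le]
    have hFy : 0 < F y := by
      have e1 : f a + (f b - f a) / (b - a) * (y - a) = μ * f a + ν * f b := by
        have : (f b - f a) / (b - a) * (ν * (b - a)) = (f b - f a) * ν := by field_simp
        rw [hya, this]; linear_combination (-(f a)) * hμν
      have e2 : η * ((y - a) * (b - y)) ≤ gap / 2 := by
        have : (y - a) * (b - y) ≤ (b - a) ^ 2 := by nlinarith
        calc η * ((y - a) * (b - y)) ≤ η * (b - a) ^ 2 := mul_le_mul_of_nonneg_left this hη0.le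
          _ = gap / 2 := by rw [hη]; field_simp
      simp only [hF]
      rw [e1]
      linarith
    -- F is continuous on [a, b]
    have hab' : Set.Icc a b ⊆ Set.Icc x z := Set.Icc_subset_Icc ha.1 hb.2
    have hFc : ContinuousOn F (Set.Icc a b) := by
      have h1 : ContinuousOn f (Set.Icc a b) := hf.mono hab'
      have h2 : Continuous fun t : ℝ => (f a + (f b - f a) / (b - a) * (t - a)) + η * ((t - a) * (b - t)) := by
        fun_prop
      have := h1.sub h2.continuousOn
      simp only [hF]
      convert this using 1
      funext t; simp only [Pi.sub_apply]; ring
    obtain ⟨s, hs, hmax⟩ := isCompact_Icc.exists_isMaxOn (Set.nonempty_Icc.2 hab.le) hFc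
    have hFs : 0 < F s := lt_of_lt_of_le hFy (hmax ⟨hy1, hy2⟩)
    have hsa : a < s := by
      rcases eq_or_lt_of_le hs.1 with h | h
      · rw [← h, hFa] at hFs; exact absurd hFs (lt_irrefl 0)
      · exact h
    have hsb : s < b := by
      rcases eq_or_lt_of_le hs.2 with h | h
      · rw [h, hFb] at hFs; exact absurd hFs (lt_irrefl 0)
      · exact h
    obtain ⟨δ, hδ, hδD⟩ := hD s (lt_of_le_of_lt ha.1 hsa) (lt_of_lt_of_le hsb hb.2) η hη0
    set h := min (δ / 2) (min (s - a) (b - s)) with hh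
    have hh0 : 0 < h := by rw [hh]; exact lt_min (by linarith) (lt_min (by linarith) (by linarith))
    have hhδ : h < δ := lt_of_le_of_lt (min_le_left _ _) (by linarith)
    have hh1 : h ≤ s - a := (min_le_right _ _).trans (min_le_left _ _)
    have hh2 : h ≤ b - s := (min_le_right _ _).trans (min_le_right _ _)
    have hp : F (s + h) ≤ F s := hmax ⟨by linarith, by linarith⟩
    have hm : F (s - h) ≤ F s := hmax ⟨by linarith, by linarith⟩
    have hsec := hδD h hh0 hhδ
    have e : F (s + h) + F (s - h) - 2 * F s = (f (s + h) + f (s - h) - 2 * f s) + 2 * η * h ^ 2 := by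
      simp only [hF]; ring
    have hη2 : 0 < η * h ^ 2 := by positivity
    have : 0 < F (s + h) + F (s - h) - 2 * F s := by
      rw [e]; linarith
    linarith
  refine ⟨convex_Icc x z, fun a ha b hb μ ν hμ hν hμν => ?_⟩
  simp only [smul_eq_mul]
  rcases lt_trichotomy a b with hab | hab | hab
  · exact aux a ha b hb hab μ ν hμ hν hμν
  · subst hab
    have : μ * a + ν * a = a := by rw [← add_mul, hμν, one_mul]
    rw [this, ← add_mul, hμν, one_mul]
  · have := aux b hb a ha hab ν μ hν hμ (by linarith)
    rw [add_comm (ν * b), add_comm (ν * f b)] at this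
    exact this

/-! ### Gluing convexity across finitely many kinks -/

/-- Slopes of secants `(g v - g u)/(v - u)`. [folklore] -/
def secant (g : ℝ → ℝ) (u v : ℝ) : ℝ := (g v - g u) / (v - u)

/-- If `slope(v,e) ≤ slope(e,w)` for `v < e < w` then `slope(v,e) ≤ slope(v,w) ≤ slope(e,w)`. [folklore] -/
private theorem secant_between {g : ℝ → ℝ} {v e w : ℝ} (hve : v < e) (hew : e < w)
    (h : secant g v e ≤ secant g e w) : secant g v e ≤ secant g v w ∧ secant g v w ≤ secant g e w := by
  unfold secant at *
  have h1 : 0 < e - v := by linarith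
  have h2 : 0 < w - e := by linarith
  have h3 : 0 < w - v := by linarith
  rw [div_le_div_iff₀ h1 h2] at h
  constructor
  · rw [div_le_div_iff₀ h1 h3]; nlinarith
  · rw [div_le_div_iff₀ h3 h2]; nlinarith

/-- **Two-piece gluing.** `g` convex on `[x, e]` and on `[e, z]`, with the kink condition
`slope(x',e) ≤ slope(e,z') + κ(z' - x')` (`x ≤ x' < e < z' ≤ z`), is convex on `[x, z]`. [folklore] -/
private theorem convexOn_Icc_glue {g : ℝ → ℝ} {x e z κ : ℝ} (hxe : x < e) (hez : e < z) (hκ : 0 ≤ κ)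
    (h1 : ConvexOn ℝ (Set.Icc x e) g) (h2 : ConvexOn ℝ (Set.Icc e z) g)
    (hkink : ∀ x' z', x ≤ x' → x' < e → e < z' → z' ≤ z →
      secant g x' e ≤ secant g e z' + κ * (z' - x')) :
    ConvexOn ℝ (Set.Icc x z) g := by
  -- the kink without slack
  have hK : ∀ u w, x ≤ u → u < e → e < w → w ≤ z → secant g u e ≤ secant g e w := by
    intro u w hxu hue hew hwz
    refine le_of_forall_gt_imp_ge_of_dense fun d hd => ?_
    set ε := d - secant g e w with hε
    have hε0 : 0 < ε := by rw [hε]; linarith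
    set τ := min (min ((e - u) / 2) ((w - e) / 2)) (ε / (2 * κ + 2)) with hτ
    have hτ0 : 0 < τ := by
      rw [hτ]; refine lt_min (lt_min (by linarith) (by linarith)) (by positivity)
    have hτ1 : τ ≤ (e - u) / 2 := (min_le_left _ _).trans (min_le_left _ _)
    have hτ2 : τ ≤ (w - e) / 2 := (min_le_left _ _).trans (min_le_right _ _)
    have hτ3 : τ ≤ ε / (2 * κ + 2) := min_le_right _ _
    set u' := e - τ with hu'
    set w' := e + τ with hw'
    -- monotonicity of secants through `e`
    have m1 : secant g u e ≤ secant g u' e := by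
      have := h1.secant_mono (a := e) (x := u) (y := u') ⟨hxe.le, le_rfl⟩ ⟨hxu, hue.le⟩
        ⟨by linarith, by linarith⟩ (by linarith) (by linarith) (by linarith)
      unfold secant
      rw [show (g e - g u) / (e - u) = (g u - g e) / (u - e) by
        rw [← neg_sub (g e) (g u), ← neg_sub e u, neg_div_neg_eq]]
      rw [show (g e - g u') / (e - u') = (g u' - g e) / (u' - e) by
        rw [← neg_sub (g e) (g u'), ← neg_sub e u', neg_div_neg_eq]]
      exact this
    have m2 : secant g e w' ≤ secant g e w := by
      have := h2.secant_mono (a := e) (x := w') (y := w) ⟨le_rfl, hez.le⟩ ⟨by linarith, by linarith⟩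
        ⟨hew.le, hwz⟩ (by linarith) (by linarith) (by linarith)
      unfold secant
      exact this
    have m3 := hkink u' w' (by linarith) (by linarith) (by linarith) (by linarith)
    have m4 : κ * (w' - u') ≤ ε := by
      rw [hw', hu']
      have : κ * (e + τ - (e - τ)) = 2 * κ * τ := by ring
      rw [this]
      calc 2 * κ * τ ≤ 2 * κ * (ε / (2 * κ + 2)) := by gcongr
        _ = ε * (2 * κ / (2 * κ + 2)) := by ring
        _ ≤ ε * 1 := by
            gcongr
            rw [div_le_one (by linarith)]; linarith
        _ = ε := mul_one _
    have : secant g u e ≤ secant g e w + ε := by linarith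
    rw [hε] at this; linarith
  rw [convexOn_iff_slope_mono_adjacent]
  refine ⟨convex_Icc x z, fun u v w hu hw huv hvw => ?_⟩
  change secant g u v ≤ secant g v w
  rcases le_or_gt w e with hwe | hwe
  · exact h1.slope_mono_adjacent ⟨hu.1, by linarith⟩ ⟨by linarith [hw.1], hwe⟩ huv hvw
  rcases le_or_gt e u with heu | heu
  · exact h2.slope_mono_adjacent ⟨heu, hu.2⟩ ⟨by linarith, hw.2⟩ huv hvw
  -- u < e < w
  rcases lt_trichotomy v e with hve | hve | hve
  · have s1 : secant g u v ≤ secant g v e :=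
      h1.slope_mono_adjacent ⟨hu.1, heu.le⟩ ⟨hxe.le, le_rfl⟩ huv hve
    have s2 : secant g v e ≤ secant g e w := hK v w (by linarith [hu.1]) hve hwe hw.2
    exact s1.trans (secant_between hve hwe s2).1
  · subst hve
    exact hK u w hu.1 huv hvw hw.2
  · have s1 : secant g u e ≤ secant g e v := hK u v hu.1 heu hve (by linarith [hw.2])
    have s2 : secant g e v ≤ secant g v w :=
      h2.slope_mono_adjacent ⟨le_rfl, hez.le⟩ ⟨hwe.le, hw.2⟩ hve hvw
    exact (secant_between heu hve s1).2.trans s2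

/-- **Gluing across finitely many kinks.** If `g` is convex on every closed interval free of points of
the finite set `E` in its interior, and satisfies the kink condition everywhere, then `g` is convex on
every `[x, z]`. [folklore] -/
private theorem convexOn_Icc_of_finite_kinks {g : ℝ → ℝ} {κ : ℝ} (hκ : 0 ≤ κ) (E : Finset ℝ)
    (hkink : ∀ x' e z', x' < e → e < z' → secant g x' e ≤ secant g e z' + κ * (z' - x'))
    (hloc : ∀ x z, x < z → (∀ e ∈ E, e ∉ Set.Ioo x z) → ConvexOn ℝ (Set.Icc x z) g) :
    ∀ x z, x < z → ConvexOn ℝ (Set.Icc x z) g := by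
  classical
  -- induction on the number of kinks strictly inside
  suffices H : ∀ N : ℕ, ∀ x z, x < z → (E.filter fun e => e ∈ Set.Ioo x z).card ≤ N →
      ConvexOn ℝ (Set.Icc x z) g from
    fun x z hxz => H _ x z hxz le_rfl
  intro N
  induction N with
  | zero =>
    intro x z hxz hN
    refine hloc x z hxz fun e he hex => ?_
    have : e ∈ E.filter fun e => e ∈ Set.Ioo x z := Finset.mem_filter.2 ⟨he, hex⟩
    rw [Nat.le_zero, Finset.card_eq_zero] at hN
    rw [hN] at this
    exact absurd this (Finset.notMem_empty e)
  | succ N ih =>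
    intro x z hxz hN
    set S := E.filter fun e => e ∈ Set.Ioo x z with hS
    by_cases hSe : S = ∅
    · refine hloc x z hxz fun e he hex => ?_
      have : e ∈ S := Finset.mem_filter.2 ⟨he, hex⟩
      rw [hSe] at this
      exact absurd this (Finset.notMem_empty e)
    have hSne : S.Nonempty := Finset.nonempty_iff_ne_empty.2 hSe
    set e₀ := S.min' hSne with he₀
    have he₀S : e₀ ∈ S := Finset.min'_mem S hSne
    have he₀' := (Finset.mem_filter.1 he₀S).2
    -- left piece: no kinks inside (x, e₀)
    have hleft : ConvexOn ℝ (Set.Icc x e₀) g := by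
      refine hloc x e₀ he₀'.1 fun e he hex => ?_
      have heS : e ∈ S := Finset.mem_filter.2 ⟨he, ⟨hex.1, hex.2.trans he₀'.2⟩⟩
      have := Finset.min'_le S e heS
      rw [← he₀] at this
      exact absurd hex.2 (not_lt.2 this)
    -- right piece: fewer kinks inside (e₀, z)
    have hright : ConvexOn ℝ (Set.Icc e₀ z) g := by
      refine ih e₀ z he₀'.2 ?_
      have hsub : (E.filter fun e => e ∈ Set.Ioo e₀ z) ⊂ S := by
        rw [Finset.ssubset_iff_subset_ne]
        constructor
        · intro e he
          have he' := Finset.mem_filter.1 he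
          exact Finset.mem_filter.2 ⟨he'.1, ⟨he₀'.1.trans he'.2.1, he'.2.2⟩⟩
        · intro heq
          have : e₀ ∈ E.filter fun e => e ∈ Set.Ioo e₀ z := by rw [heq]; exact he₀S
          exact absurd (Finset.mem_filter.1 this).2.1 (lt_irrefl _)
      have := Finset.card_lt_card hsub
      omega
    exact convexOn_Icc_glue he₀'.1 he₀'.2 hκ hleft hright
      fun x' z' _ hx'e hez' _ => hkink x' e₀ z' hx'e hez'

/-- From convexity on all closed intervals to convexity on `ℝ`. [folklore] -/
private theorem convexOn_univ_of_Icc {g : ℝ → ℝ} (h : ∀ x z, x < z → ConvexOn ℝ (Set.Icc x z) g) :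
    ConvexOn ℝ Set.univ g := by
  rw [convexOn_iff_slope_mono_adjacent]
  refine ⟨convex_univ, fun u v w _ _ huv hvw => ?_⟩
  exact (h u w (huv.trans hvw)).slope_mono_adjacent ⟨le_rfl, (huv.trans hvw).le⟩
    ⟨(huv.trans hvw).le, le_rfl⟩ huv hvw

/-- The kink condition for `g = Φ - κ t²` with `Φ` convex on `ℝ`:
`slope_g(x',e) ≤ slope_g(e,z') + κ(z' - x')`. [folklore] -/
private theorem kink_of_convex_sub_sq {Φ g : ℝ → ℝ} {κ : ℝ} (hΦ : ConvexOn ℝ Set.univ Φ)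
    (hg : ∀ t, g t = Φ t - κ * t ^ 2) {x' e z' : ℝ} (hx : x' < e) (hz : e < z') :
    secant g x' e ≤ secant g e z' + κ * (z' - x') := by
  have hs := hΦ.slope_mono_adjacent (Set.mem_univ x') (Set.mem_univ z') hx hz
  unfold secant
  rw [hg, hg, hg]
  have h1 : 0 < e - x' := by linarith
  have h2 : 0 < z' - e := by linarith
  have e1 : (Φ e - κ * e ^ 2 - (Φ x' - κ * x' ^ 2)) / (e - x') = (Φ e - Φ x') / (e - x') - κ * (e + x') := by
    field_simp; ring
  have e2 : (Φ z' - κ * z' ^ 2 - (Φ e - κ * e ^ 2)) / (z' - e) = (Φ z' - Φ e) / (z' - e) - κ * (z' + e) := by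
    field_simp; ring
  rw [e1, e2]
  linarith


end RealAnalysis

section MatrixLemmas


variable {n : Type*} [Fintype n] [DecidableEq n]

omit [Fintype n] [DecidableEq n] in
/-- Over `ℝ` the conjugate transpose is the transpose. [folklore] -/
private theorem conjTranspose_eq_transpose_real'' {m : Type*} (W : Matrix m m ℝ) : Wᴴ = Wᵀ := by
  ext i j; simp [conjTranspose_apply]

omit [Fintype n] [DecidableEq n] in
/-- Over `ℝ`, Hermitian means symmetric. [folklore] -/
private theorem isHermitian_iff_transpose' {m : Type*} (M : Matrix m m ℝ) : M.IsHermitian ↔ Mᵀ = M := by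
  unfold Matrix.IsHermitian
  rw [conjTranspose_eq_transpose_real'']

omit [Fintype n] [DecidableEq n] in
/-- `X + tY` is symmetric. [folklore] -/
private theorem isHermitian_add_smul {X Y : Matrix n n ℝ} (hX : X.IsHermitian) (hY : Y.IsHermitian) (t : ℝ) :
    (X + t • Y).IsHermitian := by
  rw [isHermitian_iff_transpose'] at hX hY ⊢
  rw [transpose_add, transpose_smul, hX, hY]

/-- `x ↦ |x|^p` is convex on `ℝ` (`p ≥ 1`). [folklore] -/
private theorem convexOn_abs_rpow' {p : ℝ} (hp : 1 ≤ p) : ConvexOn ℝ Set.univ (fun x : ℝ => |x| ^ p) := by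
  refine ⟨convex_univ, fun x _ y _ a b ha hb hab => ?_⟩
  have htri : |a • x + b • y| ≤ a • |x| + b • |y| := by
    calc |a • x + b • y| ≤ |a • x| + |b • y| := abs_add_le _ _
      _ = a • |x| + b • |y| := by
          rw [smul_eq_mul, smul_eq_mul, smul_eq_mul, smul_eq_mul, abs_mul, abs_mul, abs_of_nonneg ha,
            abs_of_nonneg hb]
  calc |a • x + b • y| ^ p ≤ (a • |x| + b • |y|) ^ p :=
        Real.rpow_le_rpow (abs_nonneg _) htri (by linarith)
    _ ≤ a • |x| ^ p + b • |y| ^ p :=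
        (convexOn_rpow hp).2 (abs_nonneg x) (abs_nonneg y) ha hb hab

/-! ### Convexity and continuity of `t ↦ Tr|X + tY|^p` -/

/-- `Tr|·|^p` is convex on symmetric matrices (`p ≥ 1`). [folklore] -/
private theorem trAbsPow_convex_comb {X Y : Matrix n n ℝ} (hX : X.IsHermitian) (hY : Y.IsHermitian) {θ : ℝ}
    (h0 : 0 ≤ θ) (h1 : θ ≤ 1) {p : ℝ} (hp : 1 ≤ p) :
    trAbsPow p (θ • X + (1 - θ) • Y) ≤ θ * trAbsPow p X + (1 - θ) * trAbsPow p Y := by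
  have hM : (θ • X + (1 - θ) • Y).IsHermitian := by
    rw [isHermitian_iff_transpose'] at hX hY ⊢
    rw [transpose_add, transpose_smul, transpose_smul, hX, hY]
  have := Literature.Analysis.Matrix.TraceJensen.re_trace_cfc_convex_le (𝕜 := ℝ) hX hY hM h0 h1 rfl
    (convexOn_abs_rpow' hp) (fun _ => Set.mem_univ _) (fun _ => Set.mem_univ _)
  simpa [trAbsPow] using this

/-- `t ↦ Tr|X+tY|^p` is convex (`p ≥ 1`). [folklore] -/
private theorem convexOn_trAbsPow_line {X Y : Matrix n n ℝ} (hX : X.IsHermitian) (hY : Y.IsHermitian) {p : ℝ}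
    (hp : 1 ≤ p) : ConvexOn ℝ Set.univ (fun t : ℝ => trAbsPow p (X + t • Y)) := by
  refine ⟨convex_univ, fun t _ t' _ a b ha hb hab => ?_⟩
  have hb' : b = 1 - a := by linarith
  have e : X + (a • t + b • t') • Y = a • (X + t • Y) + (1 - a) • (X + t' • Y) := by
    rw [hb']; simp only [smul_eq_mul]; module
  simp only
  rw [e, hb']
  exact trAbsPow_convex_comb (isHermitian_add_smul hX hY t) (isHermitian_add_smul hX hY t') ha
    (by linarith) hp

/-- `t ↦ Tr|X+tY|^p` is continuous (a finite convex function). [folklore] -/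
private theorem continuous_trAbsPow_line {X Y : Matrix n n ℝ} (hX : X.IsHermitian) (hY : Y.IsHermitian) {p : ℝ}
    (hp : 1 ≤ p) : Continuous (fun t : ℝ => trAbsPow p (X + t • Y)) := by
  have := (convexOn_trAbsPow_line hX hY hp).continuousOn isOpen_univ
  exact continuousOn_univ.1 this

/-- `Tr|X+tY|^p ≥ 0`. [folklore] -/
private theorem trAbsPow_line_nonneg {X Y : Matrix n n ℝ} (hX : X.IsHermitian) (hY : Y.IsHermitian) (p t : ℝ) :
    0 ≤ trAbsPow p (X + t • Y) :=
  trAbsPow_nonneg p (isHermitian_add_smul hX hY t)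

/-- `t ↦ ‖X + tY‖_p² = (Tr|X+tY|^p)^{2/p}` is convex (`1 ≤ p ≤ 2`). [folklore] -/
private theorem convexOn_normSq_line {X Y : Matrix n n ℝ} (hX : X.IsHermitian) (hY : Y.IsHermitian) {p : ℝ}
    (hp1 : 1 ≤ p) (hp2 : p ≤ 2) :
    ConvexOn ℝ Set.univ (fun t : ℝ => trAbsPow p (X + t • Y) ^ (2 / p)) := by
  have hq : 1 ≤ 2 / p := by rw [le_div_iff₀ (by linarith)]; linarith
  have hS := convexOn_trAbsPow_line hX hY hp1
  refine ⟨convex_univ, fun t _ t' _ a b ha hb hab => ?_⟩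
  have h1 := hS.2 (Set.mem_univ t) (Set.mem_univ t') ha hb hab
  simp only [smul_eq_mul] at h1 ⊢
  calc trAbsPow p (X + (a * t + b * t') • Y) ^ (2 / p)
      ≤ (a * trAbsPow p (X + t • Y) + b * trAbsPow p (X + t' • Y)) ^ (2 / p) :=
        Real.rpow_le_rpow (trAbsPow_line_nonneg hX hY p _) h1 (by positivity)
    _ ≤ a * trAbsPow p (X + t • Y) ^ (2 / p) + b * trAbsPow p (X + t' • Y) ^ (2 / p) := by
        have := (convexOn_rpow hq).2 (Set.mem_Ici.2 (trAbsPow_line_nonneg hX hY p t))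
          (Set.mem_Ici.2 (trAbsPow_line_nonneg hX hY p t')) ha hb hab
        simpa only [smul_eq_mul] using this

/-- `t ↦ (Tr|X+tY|^p)^{2/p}` is continuous. [folklore] -/
private theorem continuous_normSq_line {X Y : Matrix n n ℝ} (hX : X.IsHermitian) (hY : Y.IsHermitian) {p : ℝ}
    (hp1 : 1 ≤ p) : Continuous (fun t : ℝ => trAbsPow p (X + t • Y) ^ (2 / p)) :=
  (continuous_trAbsPow_line hX hY hp1).rpow_const fun _ => Or.inr (by positivity)

/-! ### The singular parameters form a finite set -/

/-- `t ↦ det (X + tY)` is a polynomial; if `det X ≠ 0` its zero set is finite. [folklore] -/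
private theorem finite_det_add_smul_eq_zero {X : Matrix n n ℝ} (hX : X.det ≠ 0) (Y : Matrix n n ℝ) :
    Set.Finite {t : ℝ | (X + t • Y).det = 0} := by
  set Q : Polynomial ℝ :=
    (X.map Polynomial.C + (Polynomial.X : Polynomial ℝ) • Y.map Polynomial.C).det with hQ
  have hev : ∀ t : ℝ, Q.eval t = (X + t • Y).det := by
    intro t
    rw [hQ, ← Polynomial.coe_evalRingHom, RingHom.map_det]
    congr 1
    ext i j
    simp [RingHom.mapMatrix_apply, Matrix.map_apply, Matrix.add_apply, Matrix.smul_apply]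
    exact mul_comm _ _
  have hQ0 : Q ≠ 0 := by
    intro h
    have := hev 0
    rw [h, Polynomial.eval_zero, zero_smul, add_zero] at this
    exact hX this.symm
  refine (Polynomial.finite_setOf_isRoot hQ0).subset fun t ht => ?_
  simp only [Set.mem_setOf_eq] at ht ⊢
  rw [Polynomial.IsRoot, hev]
  exact ht

/-- For small `ε > 0`, `X + ε·1` is invertible. [folklore] -/
private theorem eventually_det_add_smul_one_ne_zero (X : Matrix n n ℝ) :
    ∀ᶠ ε in 𝓝[>] (0 : ℝ), (X + ε • (1 : Matrix n n ℝ)).det ≠ 0 := by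
  have hev : ∀ ε : ℝ, (-X).charpoly.eval ε = (X + ε • (1 : Matrix n n ℝ)).det := by
    intro ε
    rw [Matrix.eval_charpoly]
    congr 1
    ext i j
    simp only [Matrix.sub_apply, Matrix.neg_apply, Matrix.add_apply, Matrix.smul_apply, Matrix.scalar_apply,
      Matrix.diagonal_apply, Matrix.one_apply, smul_eq_mul]
    split_ifs <;> ring
  have hfin : Set.Finite {ε : ℝ | (X + ε • (1 : Matrix n n ℝ)).det = 0} := by
    refine (Polynomial.finite_setOf_isRoot (Matrix.charpoly_monic (-X)).ne_zero).subset fun ε hε => ?_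
    simp only [Set.mem_setOf_eq] at hε ⊢
    rw [Polynomial.IsRoot, hev]; exact hε
  -- a finite set is eventually avoided by `𝓝[>] 0`
  obtain ⟨E, hE⟩ := hfin.exists_finset_coe
  have hpos : ∀ᶠ ε in 𝓝[>] (0 : ℝ), 0 < ε := self_mem_nhdsWithin
  have heach : ∀ e ∈ E, ∀ᶠ ε in 𝓝[>] (0 : ℝ), ε ≠ e := by
    intro e _
    rcases le_or_gt e 0 with he | he
    · exact hpos.mono fun ε hε h => by rw [h] at hε; exact absurd hε (not_lt.2 he)
    · have : Set.Iio e ∈ 𝓝[>] (0 : ℝ) := mem_nhdsWithin_of_mem_nhds (Iio_mem_nhds he)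
      exact Filter.mem_of_superset this fun ε hε h => by
        rw [h] at hε; exact absurd hε (lt_irrefl e)
  have hall := (Filter.eventually_all_finset E).2 heach
  refine hall.mono fun ε hε hdet => ?_
  have : ε ∈ ({ε : ℝ | (X + ε • (1 : Matrix n n ℝ)).det = 0} : Set ℝ) := hdet
  rw [← hE] at this
  exact hε ε (Finset.mem_coe.1 this) rfl

/-! ### `Tr|·|^p` on block-diagonal matrices and on `-Y` -/

/-- `Tr|A ⊕ B|^p = Tr|A|^p + Tr|B|^p`. [folklore] -/
private theorem trAbsPow_fromBlocks {m : Type*} [Fintype m] [DecidableEq m] {A : Matrix n n ℝ} {B : Matrix m m ℝ}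
    (hA : A.IsHermitian) (hB : B.IsHermitian) (p : ℝ) :
    trAbsPow p (Matrix.fromBlocks A 0 0 B) = trAbsPow p A + trAbsPow p B := by
  have hM : (Matrix.fromBlocks A 0 0 B).IsHermitian :=
    Matrix.IsHermitian.fromBlocks hA (by simp) hB
  rw [trAbsPow_eq_sum p hM, trAbsPow_eq_sum p hA, trAbsPow_eq_sum p hB]
  have hc : (Matrix.fromBlocks A 0 0 B).charpoly = A.charpoly * B.charpoly :=
    Matrix.charpoly_fromBlocks_zero₁₂ A 0 B
  have hr := congrArg Polynomial.roots hc
  rw [Polynomial.roots_mul (mul_ne_zero (Matrix.charpoly_monic A).ne_zero (Matrix.charpoly_monic B).ne_zero),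
    hM.roots_charpoly_eq_eigenvalues, hA.roots_charpoly_eq_eigenvalues, hB.roots_charpoly_eq_eigenvalues] at hr
  have h2 := congrArg (fun s : Multiset ℝ => (s.map (fun z => |RCLike.re z| ^ p)).sum) hr
  simpa only [Multiset.map_add, Multiset.sum_add, Multiset.map_map, Function.comp_def, RCLike.ofReal_re,
    Finset.sum_eq_multiset_sum, RCLike.re_to_real, RCLike.ofReal_real_eq_id, id] using h2

/-- `Tr|-Y|^p = Tr|Y|^p`. [folklore] -/
private theorem trAbsPow_neg {Y : Matrix n n ℝ} (hY : Y.IsHermitian) {p : ℝ} (hp : 0 < p) :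
    trAbsPow p (-Y) = trAbsPow p Y := by
  have hYsa : IsSelfAdjoint Y := hY.isSelfAdjoint
  unfold trAbsPow
  have hcont : Continuous fun x : ℝ => |x| ^ p := continuous_abs.rpow_const fun _ => Or.inr hp.le
  have h := cfc_comp_neg (R := ℝ) (fun x : ℝ => |x| ^ p) Y (hf := hcont.continuousOn)
  have e : (fun x : ℝ => |(-x)| ^ p) = fun x : ℝ => |x| ^ p := by funext x; rw [abs_neg]
  rw [← h, e]


end MatrixLemmas

/-! ### Globalisation: convexity of `t ↦ ‖X + tY‖_p² − (p−1) t² ‖Y‖_p²` -/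

section Global

variable {n : Type*} [Fintype n] [DecidableEq n]

/-- **Convexity of `g(t) = ‖X+tY‖_p² − (p−1)t²‖Y‖_p²` for invertible `X`** (`1 < p < 2`): the local
second-difference bound (`BallCarlenLiebLocal.normSq_second_difference`) at every nonsingular `t`, the
pseudo-derivative lemma on each interval free of the finitely many singular `t`, and gluing across the
singular `t` using the convexity of `t ↦ ‖X+tY‖_p²`.
[cite: RicardXu2016, §2, proof of Thm. 2 ("the function f … satisfies D²f ≥ 0, so it is convex")] -/
theorem convexOn_normSq_sub_sq [Nonempty n] {X Y : Matrix n n ℝ} (hX : X.IsHermitian) (hY : Y.IsHermitian)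
    (hdet : X.det ≠ 0) {p : ℝ} (hp1 : 1 < p) (hp2 : p < 2) :
    ConvexOn ℝ Set.univ
      (fun t : ℝ => trAbsPow p (X + t • Y) ^ (2 / p) - (p - 1) * trAbsPow p Y ^ (2 / p) * t ^ 2) := by
  set κ := (p - 1) * trAbsPow p Y ^ (2 / p) with hκ
  have hκ0 : 0 ≤ κ := by
    rw [hκ]; exact mul_nonneg (by linarith) (Real.rpow_nonneg (trAbsPow_nonneg p hY) _)
  set Φ : ℝ → ℝ := fun t => trAbsPow p (X + t • Y) ^ (2 / p) with hΦ
  set g : ℝ → ℝ := fun t => trAbsPow p (X + t • Y) ^ (2 / p) - (p - 1) * trAbsPow p Y ^ (2 / p) * t ^ 2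
    with hgdef
  have hg : ∀ t, g t = Φ t - κ * t ^ 2 := fun t => by simp only [hgdef, hΦ, hκ]
  have hΦc : ConvexOn ℝ Set.univ Φ := convexOn_normSq_line hX hY hp1.le hp2.le
  have hgc : Continuous g := by
    have h1 := continuous_normSq_line hX hY hp1.le
    have : g = fun t => trAbsPow p (X + t • Y) ^ (2 / p) - κ * t ^ 2 := by funext t; exact hg t
    rw [this]
    fun_prop
  obtain ⟨E, hE⟩ := (finite_det_add_smul_eq_zero hdet Y).exists_finset_coe
  have hEmem : ∀ t : ℝ, (X + t • Y).det = 0 → t ∈ E := by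
    intro t ht
    have : t ∈ ({t : ℝ | (X + t • Y).det = 0} : Set ℝ) := ht
    rw [← hE] at this
    exact Finset.mem_coe.1 this
  -- local convexity on kink-free intervals
  have hloc : ∀ x z, x < z → (∀ e ∈ E, e ∉ Set.Ioo x z) → ConvexOn ℝ (Set.Icc x z) g := by
    intro x z hxz hfree
    refine convexOn_Icc_of_second_difference hgc.continuousOn fun s hxs hsz ε hε => ?_
    have hsdet : (X + s • Y).det ≠ 0 := fun h => hfree s (hEmem s h) ⟨hxs, hsz⟩
    obtain ⟨δ, hδ, C, hC⟩ :=
      normSq_second_difference (isHermitian_add_smul hX hY s) hY hsdet hp1 hp2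
    refine ⟨min δ (ε / (|C| + 1)), by positivity, fun h hh0 hhδ => ?_⟩
    have hh1 : h ≤ δ := hhδ.le.trans (min_le_left _ _)
    have hh2 : h ≤ ε / (|C| + 1) := hhδ.le.trans (min_le_right _ _)
    have habs : |h| = h := abs_of_pos hh0
    have h1 := hC h (by rw [habs]; exact hh1)
    rw [habs] at h1
    have e1 : X + s • Y + h • Y = X + (s + h) • Y := by rw [add_smul, add_assoc]
    have e2 : X + s • Y - h • Y = X + (s - h) • Y := by rw [sub_smul, add_sub_assoc]
    rw [e1, e2] at h1
    rw [hg, hg, hg]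
    have hC3 : C * h ^ 3 ≤ ε * h ^ 2 := by
      have : C * h ≤ ε := by
        calc C * h ≤ |C| * h := mul_le_mul_of_nonneg_right (le_abs_self C) hh0.le
          _ ≤ |C| * (ε / (|C| + 1)) := mul_le_mul_of_nonneg_left hh2 (abs_nonneg C)
          _ = ε * (|C| / (|C| + 1)) := by ring
          _ ≤ ε * 1 := by
              gcongr; rw [div_le_one (by positivity)]; linarith [abs_nonneg C]
          _ = ε := mul_one ε
      nlinarith [sq_nonneg h]
    have e3 : κ * (s + h) ^ 2 + κ * (s - h) ^ 2 - 2 * (κ * s ^ 2) = 2 * κ * h ^ 2 := by ring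
    simp only [hΦ]
    nlinarith [h1, hC3, e3]
  have hkink : ∀ x' e z', x' < e → e < z' → secant g x' e ≤ secant g e z' + κ * (z' - x') :=
    fun x' e z' hx hz => kink_of_convex_sub_sq hΦc hg hx hz
  exact convexOn_univ_of_Icc (convexOn_Icc_of_finite_kinks hκ0 E hkink hloc)

/-- **(BCL) for invertible `X`**, `1 < p < 2`:
`2‖X‖_p² + 2(p−1)‖Y‖_p² ≤ ‖X+Y‖_p² + ‖X−Y‖_p²` (unnormalised `‖M‖_p² = (Tr|M|^p)^{2/p}`).
[cite: RicardXu2016, Thm. 2 (BCL), proof] [cite: BallCarlenLieb1994, Thm. 1] -/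
theorem two_point_sq_of_det [Nonempty n] {X Y : Matrix n n ℝ} (hX : X.IsHermitian) (hY : Y.IsHermitian)
    (hdet : X.det ≠ 0) {p : ℝ} (hp1 : 1 < p) (hp2 : p < 2) :
    2 * trAbsPow p X ^ (2 / p) + 2 * (p - 1) * trAbsPow p Y ^ (2 / p) ≤
      trAbsPow p (X + Y) ^ (2 / p) + trAbsPow p (X - Y) ^ (2 / p) := by
  have hc := convexOn_normSq_sub_sq hX hY hdet hp1 hp2
  have h := hc.2 (Set.mem_univ (1 : ℝ)) (Set.mem_univ (-1 : ℝ)) (by norm_num : (0 : ℝ) ≤ 1 / 2)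
    (by norm_num : (0 : ℝ) ≤ 1 / 2) (by norm_num)
  simp only [smul_eq_mul] at h
  norm_num at h
  rw [← sub_eq_add_neg] at h
  linarith

/-- **(BCL)**, `1 < p < 2`, all real symmetric `X`, `Y`: the invertibility of `X` is removed by
`X + ε·1`, `ε → 0⁺`. [cite: RicardXu2016, Thm. 2 (BCL), proof ("Letting ε → 0 …")]
[cite: BallCarlenLieb1994, Thm. 1] -/
theorem two_point_sq_of_lt [Nonempty n] {X Y : Matrix n n ℝ} (hX : X.IsHermitian) (hY : Y.IsHermitian)
    {p : ℝ} (hp1 : 1 < p) (hp2 : p < 2) :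
    2 * trAbsPow p X ^ (2 / p) + 2 * (p - 1) * trAbsPow p Y ^ (2 / p) ≤
      trAbsPow p (X + Y) ^ (2 / p) + trAbsPow p (X - Y) ^ (2 / p) := by
  have h1 : (1 : Matrix n n ℝ).IsHermitian := Matrix.isHermitian_one
  have hXe : ∀ ε : ℝ, (X + ε • (1 : Matrix n n ℝ)).IsHermitian := fun ε => isHermitian_add_smul hX h1 ε
  -- the inequality for `X + ε·1`, eventually
  have hev : ∀ᶠ ε in 𝓝[>] (0 : ℝ),
      2 * trAbsPow p (X + ε • (1 : Matrix n n ℝ)) ^ (2 / p) + 2 * (p - 1) * trAbsPow p Y ^ (2 / p) ≤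
        trAbsPow p ((X + Y) + ε • (1 : Matrix n n ℝ)) ^ (2 / p)
          + trAbsPow p ((X - Y) + ε • (1 : Matrix n n ℝ)) ^ (2 / p) := by
    refine (eventually_det_add_smul_one_ne_zero X).mono fun ε hε => ?_
    have h := two_point_sq_of_det (hXe ε) hY hε hp1 hp2
    have e1 : X + ε • (1 : Matrix n n ℝ) + Y = (X + Y) + ε • (1 : Matrix n n ℝ) := by abel
    have e2 : X + ε • (1 : Matrix n n ℝ) - Y = (X - Y) + ε • (1 : Matrix n n ℝ) := by abel
    rw [e1, e2] at h
    exact h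
  -- continuity in `ε`
  have hXY : (X + Y).IsHermitian := by
    rw [isHermitian_iff_transpose'] at hX hY ⊢; rw [transpose_add, hX, hY]
  have hXY' : (X - Y).IsHermitian := by
    rw [isHermitian_iff_transpose'] at hX hY ⊢; rw [transpose_sub, hX, hY]
  have cA : Tendsto (fun ε : ℝ => 2 * trAbsPow p (X + ε • (1 : Matrix n n ℝ)) ^ (2 / p)
      + 2 * (p - 1) * trAbsPow p Y ^ (2 / p)) (𝓝[>] (0 : ℝ))
      (𝓝 (2 * trAbsPow p X ^ (2 / p) + 2 * (p - 1) * trAbsPow p Y ^ (2 / p))) := by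
    have hc := ((continuous_normSq_line hX h1 hp1.le).tendsto 0).mono_left
      (nhdsWithin_le_nhds (s := Set.Ioi (0 : ℝ)))
    simp only [zero_smul, add_zero] at hc
    exact (hc.const_mul 2).add_const _
  have cB : Tendsto (fun ε : ℝ => trAbsPow p ((X + Y) + ε • (1 : Matrix n n ℝ)) ^ (2 / p)
      + trAbsPow p ((X - Y) + ε • (1 : Matrix n n ℝ)) ^ (2 / p)) (𝓝[>] (0 : ℝ))
      (𝓝 (trAbsPow p (X + Y) ^ (2 / p) + trAbsPow p (X - Y) ^ (2 / p))) := by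
    have hc1 := ((continuous_normSq_line hXY h1 hp1.le).tendsto 0).mono_left
      (nhdsWithin_le_nhds (s := Set.Ioi (0 : ℝ)))
    have hc2 := ((continuous_normSq_line hXY' h1 hp1.le).tendsto 0).mono_left
      (nhdsWithin_le_nhds (s := Set.Ioi (0 : ℝ)))
    simp only [zero_smul, add_zero] at hc1 hc2
    exact hc1.add hc2
  exact le_of_tendsto_of_tendsto cA cB hev

/-- Continuity of `p ↦ (Tr|M|^p)^{2/p}` at every `p₀ > 0`. [folklore] -/
private theorem continuousAt_normSq_exponent {M : Matrix n n ℝ} (hM : M.IsHermitian) {p₀ : ℝ} (hp₀ : 0 < p₀) :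
    ContinuousAt (fun p : ℝ => trAbsPow p M ^ (2 / p)) p₀ := by
  have hS : ContinuousAt (fun p : ℝ => trAbsPow p M) p₀ := by
    have e : (fun p : ℝ => trAbsPow p M) = fun p : ℝ => ∑ k, |hM.eigenvalues k| ^ p := by
      funext p; exact trAbsPow_eq_sum p hM
    rw [e]
    exact tendsto_finsetSum _ fun k _ => Real.continuousAt_const_rpow' hp₀.ne'
  have hq : ContinuousAt (fun p : ℝ => 2 / p) p₀ :=
    ContinuousAt.div continuousAt_const continuousAt_id hp₀.ne'
  exact hS.rpow hq (Or.inr (by positivity))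

/-- **The Ball–Carlen–Lieb two-point inequality ("optimal 2-uniform convexity of `S_p`"), squared-norm
form**, for real symmetric matrices and `1 ≤ p ≤ 2`:
`‖X+Y‖_p² + ‖X−Y‖_p² ≥ 2‖X‖_p² + 2(p−1)‖Y‖_p²` with `‖M‖_p² = (Tr|M|^p)^{2/p}` (the endpoints
`p = 1, 2` by continuity in `p`). [cite: BallCarlenLieb1994, Thm. 1] [cite: RicardXu2016, Thm. 2 (BCL)] -/
theorem two_point_sq [Nonempty n] {X Y : Matrix n n ℝ} (hX : X.IsHermitian) (hY : Y.IsHermitian)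
    {p : ℝ} (hp1 : 1 ≤ p) (hp2 : p ≤ 2) :
    2 * trAbsPow p X ^ (2 / p) + 2 * (p - 1) * trAbsPow p Y ^ (2 / p) ≤
      trAbsPow p (X + Y) ^ (2 / p) + trAbsPow p (X - Y) ^ (2 / p) := by
  have hXY : (X + Y).IsHermitian := by
    rw [isHermitian_iff_transpose'] at hX hY ⊢; rw [transpose_add, hX, hY]
  have hXY' : (X - Y).IsHermitian := by
    rw [isHermitian_iff_transpose'] at hX hY ⊢; rw [transpose_sub, hX, hY]
  -- `F p = RHS - LHS` is continuous at every `p > 0` and `≥ 0` on `(1, 2)`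
  set F : ℝ → ℝ := fun p => trAbsPow p (X + Y) ^ (2 / p) + trAbsPow p (X - Y) ^ (2 / p)
    - (2 * trAbsPow p X ^ (2 / p) + 2 * (p - 1) * trAbsPow p Y ^ (2 / p)) with hF
  have hFc : ∀ p₀ : ℝ, 0 < p₀ → ContinuousAt F p₀ := by
    intro p₀ hp₀
    simp only [hF]
    have h1 := continuousAt_normSq_exponent hXY hp₀
    have h2 := continuousAt_normSq_exponent hXY' hp₀
    have h3 := continuousAt_normSq_exponent hX hp₀
    have h4 := continuousAt_normSq_exponent hY hp₀
    have h5 : ContinuousAt (fun p : ℝ => 2 * (p - 1)) p₀ := by fun_prop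
    exact (h1.add h2).sub ((h3.const_mul 2).add (h5.mul h4))
  have hFpos : ∀ p, 1 < p → p < 2 → 0 ≤ F p := by
    intro p h1 h2; simp only [hF]; linarith [two_point_sq_of_lt hX hY h1 h2]
  suffices h : 0 ≤ F p by simp only [hF] at h; linarith
  rcases eq_or_lt_of_le hp1 with h1 | h1
  · -- p = 1
    subst h1
    have hev : ∀ᶠ p in 𝓝[>] (1 : ℝ), 0 ≤ F p := by
      have h2 : Set.Iio (2 : ℝ) ∈ 𝓝[>] (1 : ℝ) := mem_nhdsWithin_of_mem_nhds (Iio_mem_nhds (by norm_num))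
      filter_upwards [h2, self_mem_nhdsWithin] with p hp2' hp1'
      exact hFpos p hp1' hp2'
    exact ge_of_tendsto (((hFc 1 one_pos).tendsto).mono_left (nhdsWithin_le_nhds (s := Set.Ioi (1 : ℝ)))) hev
  rcases eq_or_lt_of_le hp2 with h2 | h2
  · -- p = 2
    subst h2
    have hev : ∀ᶠ p in 𝓝[<] (2 : ℝ), 0 ≤ F p := by
      have h2 : Set.Ioi (1 : ℝ) ∈ 𝓝[<] (2 : ℝ) := mem_nhdsWithin_of_mem_nhds (Ioi_mem_nhds (by norm_num))
      filter_upwards [h2, self_mem_nhdsWithin] with p hp1' hp2'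
      exact hFpos p hp1' hp2'
    exact ge_of_tendsto (((hFc 2 two_pos).tendsto).mono_left (nhdsWithin_le_nhds (s := Set.Iio (2 : ℝ)))) hev
  exact hFpos p h1 h2

/-- **The Ball–Carlen–Lieb two-point inequality, power-mean form**, real symmetric matrices,
`1 ≤ p ≤ 2`: `(Tr|X|^p)^{2/p} + (p−1)(Tr|Y|^p)^{2/p} ≤ ((Tr|X+Y|^p + Tr|X−Y|^p)/2)^{2/p}`
— from the squared-norm form applied to `X ⊕ X`, `Y ⊕ (−Y)`.
[cite: BallCarlenLieb1994, Thm. 1] [cite: BenAroyaRegevDeWolf2008, Lemma 4 (§3)] -/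
theorem two_point_powerMean [Nonempty n] {X Y : Matrix n n ℝ} (hX : X.IsHermitian) (hY : Y.IsHermitian)
    {p : ℝ} (hp1 : 1 ≤ p) (hp2 : p ≤ 2) :
    trAbsPow p X ^ (2 / p) + (p - 1) * trAbsPow p Y ^ (2 / p) ≤
      ((trAbsPow p (X + Y) + trAbsPow p (X - Y)) / 2) ^ (2 / p) := by
  have hp0 : 0 < p := by linarith
  set X' : Matrix (n ⊕ n) (n ⊕ n) ℝ := Matrix.fromBlocks X 0 0 X with hX'
  set Y' : Matrix (n ⊕ n) (n ⊕ n) ℝ := Matrix.fromBlocks Y 0 0 (-Y) with hY'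
  have hYn : (-Y).IsHermitian := hY.neg
  have hX'h : X'.IsHermitian := Matrix.IsHermitian.fromBlocks hX (by simp) hX
  have hY'h : Y'.IsHermitian := Matrix.IsHermitian.fromBlocks hY (by simp) hYn
  have hXY : (X + Y).IsHermitian := by
    rw [isHermitian_iff_transpose'] at hX hY ⊢; rw [transpose_add, hX, hY]
  have hXY' : (X - Y).IsHermitian := by
    rw [isHermitian_iff_transpose'] at hX hY ⊢; rw [transpose_sub, hX, hY]
  have h := two_point_sq hX'h hY'h hp1 hp2
  have e1 : X' + Y' = Matrix.fromBlocks (X + Y) 0 0 (X - Y) := by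
    rw [hX', hY', Matrix.fromBlocks_add, add_zero, sub_eq_add_neg]
  have e2 : X' - Y' = Matrix.fromBlocks (X - Y) 0 0 (X + Y) := by
    rw [hX', hY', sub_eq_add_neg, Matrix.fromBlocks_neg, Matrix.fromBlocks_add, neg_zero, add_zero, neg_neg,
      ← sub_eq_add_neg]
  rw [e1, e2, trAbsPow_fromBlocks hXY hXY', trAbsPow_fromBlocks hXY' hXY, hX', hY',
    trAbsPow_fromBlocks hX hX, trAbsPow_fromBlocks hY hYn, trAbsPow_neg hY hp0] at h
  set T := trAbsPow p (X + Y) + trAbsPow p (X - Y) with hT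
  have hT' : trAbsPow p (X - Y) + trAbsPow p (X + Y) = T := by rw [hT, add_comm]
  rw [hT'] at h
  have hSX : 0 ≤ trAbsPow p X := trAbsPow_nonneg p hX
  have hSY : 0 ≤ trAbsPow p Y := trAbsPow_nonneg p hY
  have hT0 : 0 ≤ T := by rw [hT]; exact add_nonneg (trAbsPow_nonneg p hXY) (trAbsPow_nonneg p hXY')
  have h2q : 0 < (2 : ℝ) ^ (2 / p) := Real.rpow_pos_of_pos two_pos _
  rw [show trAbsPow p X + trAbsPow p X = 2 * trAbsPow p X by ring,
    show trAbsPow p Y + trAbsPow p Y = 2 * trAbsPow p Y by ring,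
    Real.mul_rpow two_pos.le hSX, Real.mul_rpow two_pos.le hSY] at h
  rw [Real.div_rpow hT0 two_pos.le, le_div_iff₀ h2q]
  nlinarith [h, h2q]

end Global

end Literature.Analysis.Matrix.BallCarlenLieb
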